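import Literature.Claims.NS.ClayVariants
import Literature.Analysis.FluidPDE.ClassicalSolution
import Literature.Analysis.FluidPDE.PeriodicGalileanNonuniqueness
import HarnessLib

/-!
# Claim skeleton: Xinyi Zhou, «Proof of the 3D Navier-Stokes equation's global existence and
# smoothness of solutions – Applying a new analytical approach with certain boundary conditions»
# (OSF Preprints rc42s, version 2, 2025; version 1, 2024)

Cell `ns-claims` (D-0090 NS-CLAIMS SWEEP), claim C120 (T3 QUICK row), typist `ns-claims-typist-5`.
UNREFEREED preprint under adjudication — NOTHING in this file asserts a step: every `Step_k` is a
`Prop`; the `theorem`s are the composition `claim_of_steps`, routine unfoldings, and the proofs of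
three TRUE statements (`step_1free_holds`, `step_2_holds` ⇒ `claimedTheorem_holds`,
`clayOverlap_trivial`, `clayReading_of_delta`) that locate the Clay delta in the kernel.

Version of record: OSF Preprints doi:10.31219/osf.io/rc42s_v2 (VERSION 2, 2025-04-07, 15 pp.; PDF
page = printed page) [ZhouXinyi2024]; v1 doi:10.31219/osf.io/rc42s (2024-04-29) differs by one
footnote (census diff); SSRN 4872354 not fetched. Text PINNED by ns-claims-census-1 at
`pub/ns-claims/census/texts/ZhouXinyi2024/{osf-rc42s_v2.pdf (sha16 24e3ae46096ec4bd), v2-pages/}`;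
pointer `pub/ns-claims/sources/ZhouXinyi2024/LOCATORS.md`. Locators below are «§n p.N» of v2.

## Claimed statement (as printed)

Title: «Proof of the 3D Navier-Stokes equation's global existence and smoothness of solutions».
Abstract p.1: «By using an entire and exclusive analytical approach, it could be shown that under
certain predefined boundary conditions and given any initial conditions, there exist solutions to
the 3D Navier-Stokes equations which are indeed globally defined and smooth.» §2.3 p.6: «We get the
following results: (a, b, c, d) = (u′, v′, w′, p′) = (0, 0, 0, 0) thus (u, v, w, p) are the
antiderivatives of (0, 0, 0, 0) = (C1, C2, C3, C4) which are 4 different constants that are globally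
defined and smooth. So the changes of velocity u, v, w over x, y, z, t would always be 0, therefore
(u, v, w) = (C1,C2,C3) which means that as long as the velocity function are constant … it does not
really matter … how fast or slow the fluid are moving». §4 p.14: «Under these circumstances of
velocity levels not changing and pressure to be linear functions, the solutions to the 3D
Navier-Stokes equations are globally defined and smooth as well given that all the predefined
boundary conditions do apply.» The «predefined boundary conditions» are the «core assumptions»
§2.1 pp.4–5: (1) ρ constant; (2) only continuity + the three momentum equations of the NASA
compressible form (1) p.3; (3) ∇·τ = 0 «also for the normal case of a positive Reynolds number
(Re > 0) for simplicity and generality reasons» (footnote 10 p.4); (4) «Velocity (u,v,w) changes are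
assumed to be constant (symmetry) resp. the same for changes in (x, y, z, t): ∂u/∂t = ∂u/∂x = ∂u/∂y
= ∂u/∂z = u′» (same for v′, w′); (5) «∂p/∂x = ∂p/∂y = ∂p/∂z = p′»; §3.1 p.10 adds (6) f_x = f_y =
f_z = f ≠ 0.

Typed: `ClaimedTheorem` = the §2.3 p.6 / §4 p.14 result AS PRINTED for the unforced model — for
every viscosity and every constant velocity level `c` («how fast or slow») there is a global
classical solution on `ℝ³ × ℝ` with that datum whose velocity never changes (it is the constant
pair); TRUE (`claimedTheorem_holds`). The title/abstract READ AS Clay (A) is `ClayReading :=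
ClayVariants.clayR3.Regularity`, reached from the paper's result exactly through `ClayDelta` (below).

## Clay delta (reference `ClayVariants.lean`)

Nearest Clay statement: (A) `clayR3.Regularity` (whole space; the paper's «boundary conditions» are
constraints on the unknowns, not a domain boundary — no Δ1). Axes: Δ4 DATA CLASS — the data the
construction covers are the CONSTANT fields (assumption 4 at t = 0 with u′ constant gives affine
data, and p.6 keeps only the constants); a Clay (A) datum (smooth, divergence-free, decay (4)) that
is constant is `≡ 0` (`clayOverlap_trivial`, PROVED), so on Clay data the paper's result is the rest
state only; `ClayDelta` («every Clay datum is constant», the bridging hypothesis under which the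
title follows: `clayReading_of_delta`, PROVED) is the kernel object — expected FALSE (any
non-constant Schwartz divergence-free datum). Δ6 ∃-EXHIBITION vs ∀-DATA: (A) quantifies over every
datum of the class; the paper exhibits solutions for special data. Δ2 EQUATION: assumption (3) sets
the viscous term to zero for Re > 0 (the equations actually solved are Euler's in conservation
form); for the constant and affine fields typed here `νΔu = 0`, so Steps 2–3 hold for NS proper —
recorded, not typed. Δ5: nonzero constants have infinite energy (7); irrelevant once Δ4 forces c = 0.
No `clay_of_claimed` (not schema-shaped: CLAYVARIANTS-USAGE «record the axis»).

## Steps (print order; private TRUE/FALSE flags are the typist's reading, not assertions)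

* Step 1 = `Step_1` — §2.2–2.3 pp.5–6, the reduction and its solution: under (1), (4), (5) the
  continuity equation reads `ρ(u′ + v′ + w′) = 0` and the three momentum equations (product rule,
  Re·ρ[…] = −Re·p′) read as the displayed system in (a, b, c, d) = (u′, v′, w′, p′) with the point
  values u(x), v(y), w(z) as coefficients (`ReducedSystem`, typed from the p.5 derivation lines; the
  p.6 copy has two slips, «v(z) a» for v·w′ in Y and «u(x) w′» for u·c in Z — `ReducedSystemP6`
  types the p.6 letters); then «We get the following results: (a, b, c, d) = (0, 0, 0, 0) … the
  changes of velocity u, v, w over x, y, z, t would ALWAYS be 0». Typed at the abstract grain (F15)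
  in the LOAD-BEARING reading — u, v, w are the ansatz fields themselves (assumption 4 with constant
  u′, v′, w′ makes each component affine in x + y + z + t: `ansatzVelocity a C`), the system holds at
  every (t, x), conclusion a = 0 ∧ d = 0: `Step_1` (and `Step_1P6` on the p.6 letters). Private flag:
  FALSE-looking — a = (1, −1, 0), C = (0, −1, 0), d = 0 (u = x+y+z+t, v = −(x+y+z+t) − 1, w = 0,
  p constant) satisfies the printed system at every point for every Re, ρ (and is an exact affine
  solution of NS obeying assumptions 1–5); on the p.6 letters a = (1, 0, −1), C = (0, 0, −1) does.
  SUPPORT reading `Step_1free` — u(x), v(y), w(z) treated as free real variables: TRUE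
  (`step_1free_holds`: the point U = 0 already forces a = 0, d = 0). Not consumed by the existence
  claim (constants solve NS whether or not they are the only ansatz solutions): erratum column
  unless the referee reads «would always be 0» as part of the claimed result.
* Step 2 = `Step_2` — §2.3 p.6 «(u, v, w, p) = (C1, C2, C3, C4) … globally defined and smooth»:
  constant velocity and constant pressure form a global classical solution of the unforced system on
  `ℝ³ × ℝ`, every ν. TRUE — `step_2_holds`.
* Step 3 = `Step_3` — §3.2 p.12 (forced model, assumption 6): «(a, b, c, d) = (0, 0, 0, ρf) … p(x)
  = ρf·x + K1, p(y) = ρf·y + K2, p(z) = ρf·z + K3»: constant velocity with the linear pressure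
  `p = f·(x + y + z) + K` solves the system forced by the constant field (f, f, f) (tree units ρ = 1,
  so the print's d = ρf is d = f). TRUE-looking (∇p = f·(1,1,1) balances the force); not proved here;
  not consumed by `ClaimedTheorem` (unforced model).
* Step 4 = `ClayDelta` — THE CLAY PASSAGE, title + abstract p.1 «given any initial conditions» + §4
  p.14 + §1 p.1 («new evidence for the existence and smoothness of global solutions … in contrast to
  the common opinion of the mathematical community»): the data covered (constants) against (A)'s
  «every smooth divergence-free datum with decay (4)». `clayReading_of_delta : ClayDelta →
  ClayReading` PROVED (a constant Clay datum is 0 by `clayOverlap_trivial`; the rest state is a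
  Clay-sense solution, tree `isNavierStokesSolution_zero`). Private flag: `ClayDelta` FALSE.

`claim_of_steps : Step_1 → Step_2 → ClaimedTheorem` uses Step 2 only (Step 1 is carried as the
printed predecessor). Not typed (with reason): the NASA compressible system (1) p.3 / (2) p.8 with
energy equation (the paper itself uses only continuity + momentum, assumption 2); assumption (3)
∇·τ = 0 as a statement about the stress tensor (no stress tensor in the tree's incompressible
vocabulary; its effect — dropping νΔu — is recorded under Δ2); the Re = 0 «edge case» footnote 10
(then the printed momentum lines read 0 = 0 and impose nothing — F8: under Re = 0 the system is
vacuous and p.6's conclusion fails trivially; `Step_1` is typed for Re > 0, ρ > 0); §3's footnote 15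
p.12 («complicated fractions … we can not be sure that the solution functions would not blow up»)
and §4's prose; v1 (identical mathematics).

WHAT THIS IS NOT: not a claim about NS regularity or blow-up; not a claim about any author beyond
the typed locator.
-/

open MeasureTheory Set Function
open scoped ContDiff Topology Laplacian InnerProductSpace ENNReal

namespace Literature.Claims.NS.ZhouXinyi2024

open Literature.Analysis.FluidPDE

noncomputable section

/-! ## Vocabulary of the paper (§2.1–§2.3 pp.4–6) -/

/-- The diagonal coordinate `s(t, x) = x + y + z + t`: under core assumption 4 p.4 with `u′`
constant, each velocity component is an affine function of `s`. [cite: ZhouXinyi2024, §2.1 assumption 4, p.4] -/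
def diag (t : ℝ) (x : EuclideanSpace ℝ (Fin 3)) : ℝ :=
  x 0 + x 1 + x 2 + t

/-- The velocity fields admitted by core assumption 4 p.4 («∂u/∂t = ∂u/∂x = ∂u/∂y = ∂u/∂z = u′»,
u′, v′, w′ constants `a 0, a 1, a 2`): `uᵢ(t, x) = aᵢ · (x + y + z + t) + Cᵢ`.
[cite: ZhouXinyi2024, §2.1 assumption 4, p.4; §2.3 p.6 «antiderivatives»] -/
def ansatzVelocity (a C : Fin 3 → ℝ) (t : ℝ) (x : EuclideanSpace ℝ (Fin 3)) :
    EuclideanSpace ℝ (Fin 3) :=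
  WithLp.toLp 2 fun i => a i * diag t x + C i

/-- Unfolding `ansatzVelocity` componentwise. [cite: ZhouXinyi2024, §2.1 assumption 4, p.4] -/
@[simp]
theorem ansatzVelocity_apply (a C : Fin 3 → ℝ) (t : ℝ) (x : EuclideanSpace ℝ (Fin 3)) (i : Fin 3) :
    ansatzVelocity a C t x i = a i * diag t x + C i :=
  rfl

/-- The printed reduced system, §2.2 p.5 (derivation lines) / §2.3 p.6, in the letters
(a, b, c, d) = (u′, v′, w′, p′) with the point values `U = (u(x), v(y), w(z))` as coefficients:
continuity `ρ(a + b + c) = 0`; X `Re·ρ[a + 2u a + (a v + u b) + a w + u c] = −Re·d`;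
Y `Re·ρ[b + (a v + u b) + 2v b + (b w + v c)] = −Re·d`; Z `Re·ρ[c + (a w + u c) + (b w + v c) + 2w c]
= −Re·d` (the conservation-form products `∂(ρuv)/∂y = ρ(u′v + u v′)` etc. expanded as printed).
[cite: ZhouXinyi2024, §2.2 p.5 and §2.3 p.6 (displayed system)] -/
def ReducedSystem (Re ρ : ℝ) (a : Fin 3 → ℝ) (d : ℝ) (U : EuclideanSpace ℝ (Fin 3)) : Prop :=
  ρ * (a 0 + a 1 + a 2) = 0 ∧
  Re * ρ * (a 0 + 2 * U 0 * a 0 + (a 0 * U 1 + U 0 * a 1) + a 0 * U 2 + U 0 * a 2) = -Re * d ∧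
  Re * ρ * (a 1 + (a 0 * U 1 + U 0 * a 1) + 2 * U 1 * a 1 + (a 1 * U 2 + U 1 * a 2)) = -Re * d ∧
  Re * ρ * (a 2 + (a 0 * U 2 + U 0 * a 2) + (a 1 * U 2 + U 1 * a 2) + 2 * U 2 * a 2) = -Re * d

/-- The same system in the letters ACTUALLY PRINTED on p.6 (two copying slips relative to the p.5
lines: Y ends «(b w(z) + v(z) a)», Z has «(a w(x) + u(x) w′)» with w′ = c).
[cite: ZhouXinyi2024, §2.3 p.6 (displayed system, as printed)] -/
def ReducedSystemP6 (Re ρ : ℝ) (a : Fin 3 → ℝ) (d : ℝ) (U : EuclideanSpace ℝ (Fin 3)) : Prop :=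
  ρ * (a 0 + a 1 + a 2) = 0 ∧
  Re * ρ * (a 0 + 2 * U 0 * a 0 + (a 0 * U 1 + U 0 * a 1) + a 0 * U 2 + U 0 * a 2) = -Re * d ∧
  Re * ρ * (a 1 + (a 0 * U 1 + U 0 * a 1) + 2 * U 1 * a 1 + (a 1 * U 2 + U 1 * a 0)) = -Re * d ∧
  Re * ρ * (a 2 + (a 0 * U 2 + U 0 * a 2) + (a 1 * U 2 + U 1 * a 2) + 2 * U 2 * a 2) = -Re * d

/-- The constant vector `(1, 1, 1)` (direction of the §3 force `f_x = f_y = f_z = f` and of the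
gradient of the linear pressure). [cite: ZhouXinyi2024, §3.1 assumption 6, p.10] -/
def ones : EuclideanSpace ℝ (Fin 3) :=
  WithLp.toLp 2 fun _ => 1

/-! ## The claimed statement and its Clay reading -/

/-- CLAIMED RESULT AS PRINTED (unforced model), §2.3 p.6 with §4 p.14 and the abstract p.1: for every
viscosity and every constant velocity level `c` («it does not really matter … how fast or slow the
fluid are moving») there are `u`, `p` forming a global classical solution of the unforced system on
`ℝ³ × ℝ` with `u(·, 0) = c` and «velocity levels not changing». TRUE (`claimedTheorem_holds`); it
is NOT Clay (A) — see `ClayReading`, `ClayDelta`. [cite: ZhouXinyi2024, §2.3 p.6; §4 p.14; abstract p.1] -/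
def ClaimedTheorem : Prop :=
  ∀ ν : ℝ, 0 < ν → ∀ c : EuclideanSpace ℝ (Fin 3),
    ∃ (u : ℝ → EuclideanSpace ℝ (Fin 3) → EuclideanSpace ℝ (Fin 3))
      (p : ℝ → EuclideanSpace ℝ (Fin 3) → ℝ),
      IsClassicalNSSolutionOn univ ν 0 u p ∧ (u 0 = fun _ => c) ∧ ∀ t x, u t x = c

/-- THE CLAY READING of the title «Proof of the 3D Navier-Stokes equation's global existence and
smoothness of solutions» and of the abstract's «given any initial conditions»: Clay (A),
`clayR3.Regularity`. The text never states (A)'s quantifier over all smooth divergence-free data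
with decay (4); this decl only names the reading against which the delta is measured.
[cite: ZhouXinyi2024, title and abstract p.1; FeffermanClay2006, (A) p.2] -/
def ClayReading : Prop :=
  ClayVariants.clayR3.Regularity

/-- STEP 4 / THE BRIDGING HYPOTHESIS (Δ4 data class, Δ6 ∃ vs ∀): «given any initial conditions»
read against (A) — every Clay (A) datum (smooth, divergence-free, rapid decay (4)) is one of the
data the construction covers, i.e. a constant field. Under it the title follows from the paper's
result (`clayReading_of_delta`); expected FALSE (refuter: any non-constant divergence-free Schwartz
datum). [cite: ZhouXinyi2024, abstract p.1 «given any initial conditions»; §4 p.14; FeffermanClay2006, (A) with (4)] -/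
def ClayDelta : Prop :=
  ∀ u₀ : EuclideanSpace ℝ (Fin 3) → EuclideanSpace ℝ (Fin 3), ContDiff ℝ ∞ u₀ →
    NSWave0.IsDivFree u₀ → HasRapidSpatialDecay u₀ → ∃ c : EuclideanSpace ℝ (Fin 3), u₀ = fun _ => c

/-! ## The printed steps -/

/-- STEP 1 (load-bearing reading), §2.2–2.3 pp.5–6: for Re > 0, ρ > 0, if the ansatz fields
`u = ansatzVelocity a C` (assumption 4) with a pressure of constant slope d (assumption 5) satisfy
the printed reduced system at every point, then «(a, b, c, d) = (0, 0, 0, 0) … the changes of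
velocity … would always be 0». Private flag: FALSE-looking (a = (1, −1, 0), C = (0, −1, 0), d = 0).
[cite: ZhouXinyi2024, §2.3 p.6 «We get the following results: (a, b, c, d) = … = (0, 0, 0, 0)»] -/
def Step_1 : Prop :=
  ∀ Re ρ : ℝ, 0 < Re → 0 < ρ → ∀ (a C : Fin 3 → ℝ) (d : ℝ),
    (∀ (t : ℝ) (x : EuclideanSpace ℝ (Fin 3)), ReducedSystem Re ρ a d (ansatzVelocity a C t x)) →
      a = 0 ∧ d = 0

/-- STEP 1 on the letters printed on p.6 (`ReducedSystemP6`). Private flag: FALSE-looking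
(a = (1, 0, −1), C = (0, 0, −1), d = 0). [cite: ZhouXinyi2024, §2.3 p.6 (system as printed)] -/
def Step_1P6 : Prop :=
  ∀ Re ρ : ℝ, 0 < Re → 0 < ρ → ∀ (a C : Fin 3 → ℝ) (d : ℝ),
    (∀ (t : ℝ) (x : EuclideanSpace ℝ (Fin 3)), ReducedSystemP6 Re ρ a d (ansatzVelocity a C t x)) →
      a = 0 ∧ d = 0

/-- STEP 1, SUPPORT reading («solving the 4 equations for (a, b, c, d)» with u(x), v(y), w(z) as
FREE real variables): if the printed system holds for every value `U`, then a = 0 and d = 0. TRUE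
(`step_1free_holds`); it is not a statement about the ansatz solutions.
[cite: ZhouXinyi2024, §2.3 p.6 «Now solving the 4 equations for the substituted variables (a, b, c, d)»] -/
def Step_1free : Prop :=
  ∀ Re ρ : ℝ, 0 < Re → 0 < ρ → ∀ (a : Fin 3 → ℝ) (d : ℝ),
    (∀ U : EuclideanSpace ℝ (Fin 3), ReducedSystem Re ρ a d U) → a = 0 ∧ d = 0

/-- STEP 2, §2.3 p.6: «(u, v, w, p) = (C1, C2, C3, C4) which are 4 different constants that are
globally defined and smooth» — the constant pair is a global classical solution of the unforced
system on `ℝ³ × ℝ`, for every viscosity. TRUE (`step_2_holds`). [cite: ZhouXinyi2024, §2.3 p.6] -/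
def Step_2 : Prop :=
  ∀ (ν : ℝ) (c : EuclideanSpace ℝ (Fin 3)) (K : ℝ),
    IsClassicalNSSolutionOn univ ν 0 (fun _ _ => c) (fun _ _ => K)

/-- STEP 3, §3.2 p.12 (forced model, assumption 6 `f_x = f_y = f_z = f`): constant velocity with the
linear pressure `p = f·(x + y + z) + K` solves the system forced by the constant field `f·(1,1,1)`
(tree units ρ = 1; the print's slope d = ρf). Private flag: TRUE-looking; not proved here.
[cite: ZhouXinyi2024, §3.2 p.12 «(a, b, c, d) = (0, 0, 0, ρf) … p(x) = ρf ∗ x + K1»] -/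
def Step_3 : Prop :=
  ∀ (ν f K : ℝ) (c : EuclideanSpace ℝ (Fin 3)),
    IsClassicalNSSolutionOn univ ν (fun _ _ => f • ones) (fun _ _ => c)
      (fun _ x => f * (x 0 + x 1 + x 2) + K)

/-! ## Composition and the true statements -/

/-- The printed argument composes: Step 2 alone yields the claimed result as printed (Step 1, the
uniqueness remark, is carried as its printed predecessor and not used).
[cite: ZhouXinyi2024, §2.3 p.6; §4 p.14] -/
theorem claim_of_steps (_h1 : Step_1) (h2 : Step_2) : ClaimedTheorem := by
  intro ν _hν c
  exact ⟨fun _ _ => c, fun _ _ => 0, h2 ν c 0, rfl, fun _ _ => rfl⟩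

/-- STEP 2 HOLDS: every term of the unforced momentum equation vanishes on a constant pair, and a
constant field is divergence free. [cite: ZhouXinyi2024, §2.3 p.6] -/
theorem step_2_holds : Step_2 := by
  intro ν c K
  refine ⟨contDiffOn_const, contDiffOn_const, ?_, ?_⟩
  · intro t _ x
    have hΔ : (Δ fun _ : EuclideanSpace ℝ (Fin 3) => c) x = 0 := by
      rw [InnerProductSpace.laplacian_eq_iteratedFDeriv_stdOrthonormalBasis]
      simp [iteratedFDeriv_const_of_ne (𝕜 := ℝ) (E := EuclideanSpace ℝ (Fin 3)) two_ne_zero c]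
    have hg : gradient (fun _ : EuclideanSpace ℝ (Fin 3) => K) x = 0 := by
      rw [gradient, fderiv_const_apply]; simp
    simp [timeDerivWithin, convect, hΔ, hg]
  · intro t _ x
    simp [VectorCalculus.divergence]

/-- The claimed result AS PRINTED is a theorem (it is not Clay (A): `ClayReading`, `ClayDelta`).
[cite: ZhouXinyi2024, §2.3 p.6; §4 p.14] -/
theorem claimedTheorem_holds : ClaimedTheorem := by
  intro ν _hν c
  exact ⟨fun _ _ => c, fun _ _ => 0, step_2_holds ν c 0, rfl, fun _ _ => rfl⟩

/-- STEP 1 in the SUPPORT reading holds: the point `U = 0` of the printed system already forces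
a = b = c = −d/ρ, and continuity then gives d = 0. [cite: ZhouXinyi2024, §2.3 p.6] -/
theorem step_1free_holds : Step_1free := by
  intro Re ρ hRe hρ a d h
  obtain ⟨hc, hx, hy, hz⟩ := h 0
  simp only [PiLp.zero_apply, mul_zero, zero_mul, add_zero] at hx hy hz
  have hRe' : Re ≠ 0 := hRe.ne'
  have hρ' : ρ ≠ 0 := hρ.ne'
  have h0 : ρ * a 0 = -d := by
    have := mul_left_cancel₀ hRe' (by rw [← mul_assoc]; linarith [hx] : Re * (ρ * a 0) = Re * (-d))
    exact this
  have h1 : ρ * a 1 = -d := by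
    exact mul_left_cancel₀ hRe' (by rw [← mul_assoc]; linarith [hy] : Re * (ρ * a 1) = Re * (-d))
  have h2 : ρ * a 2 = -d := by
    exact mul_left_cancel₀ hRe' (by rw [← mul_assoc]; linarith [hz] : Re * (ρ * a 2) = Re * (-d))
  have hd : d = 0 := by
    have : ρ * (a 0 + a 1 + a 2) = -3 * d := by rw [mul_add, mul_add, h0, h1, h2]; ring
    linarith [hc, this]
  subst hd
  refine ⟨?_, rfl⟩
  funext i
  fin_cases i
  · simpa [hρ'] using h0
  · simpa [hρ'] using h1
  · simpa [hρ'] using h2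

/-- Δ4 IN THE KERNEL: a Clay (A) datum that is constant is identically zero (decay (4) with
n = 0, K = 1: `(1 + ‖x‖)·‖c‖ ≤ C` for all `x` forces `c = 0`).
[cite: FeffermanClay2006, (4) p.1; ZhouXinyi2024, §2.3 p.6 (constant solutions)] -/
theorem clayOverlap_trivial (c : EuclideanSpace ℝ (Fin 3))
    (h : HasRapidSpatialDecay (fun _ : EuclideanSpace ℝ (Fin 3) => c)) : c = 0 := by
  by_contra hc
  obtain ⟨C, hC⟩ := h 0 1
  have hpos : 0 < ‖c‖ := norm_pos_iff.mpr hc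
  -- evaluate the decay bound at a far point on the first axis
  set R : ℝ := max C 0 / ‖c‖ + 1 with hR
  have hRpos : 0 < R := by
    have : 0 ≤ max C 0 / ‖c‖ := div_nonneg (le_max_right _ _) hpos.le
    linarith
  have hx := hC (R • EuclideanSpace.single 0 (1 : ℝ))
  have hn : ‖(EuclideanSpace.single 0 (1 : ℝ) : EuclideanSpace ℝ (Fin 3))‖ = 1 := by
    simp [EuclideanSpace.single, PiLp.norm_single]
  rw [pow_one, norm_iteratedFDeriv_zero, norm_smul, hn, mul_one,
    Real.norm_of_nonneg hRpos.le] at hx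
  have h1 : (1 + R) * ‖c‖ ≤ max C 0 := hx.trans (le_max_left _ _)
  have h2 : R * ‖c‖ = max C 0 + ‖c‖ := by
    rw [hR, add_mul, one_mul, div_mul_cancel₀ _ hpos.ne']
  nlinarith

/-- STEP 4 IN THE KERNEL: under the bridging hypothesis `ClayDelta` the title's Clay reading follows
from the paper's result — a constant Clay datum is 0 (`clayOverlap_trivial`) and the rest state is a
Clay-sense solution (tree `isNavierStokesSolution_zero`). The content of the row is that `ClayDelta`
is false, not that (A) holds. [cite: ZhouXinyi2024, abstract p.1, §4 p.14; FeffermanClay2006, (A) p.2] -/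
theorem clayReading_of_delta (hΔ : ClayDelta) : ClayReading := by
  intro ν _hν u₀ hu₀ hdiv hdec
  obtain ⟨c, rfl⟩ := hΔ u₀ hu₀ hdiv hdec
  have hc : c = 0 := clayOverlap_trivial c hdec
  subst hc
  obtain ⟨hsol, hsu, hsp⟩ := isNavierStokesSolution_zero (E := EuclideanSpace ℝ (Fin 3)) ν
  refine ⟨0, 0, hsu, hsp, ?_, ?_⟩
  · have h0 : (fun _ : EuclideanSpace ℝ (Fin 3) => (0 : EuclideanSpace ℝ (Fin 3))) = 0 := rfl
    rw [h0]
    exact hsol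
  · refine ⟨0, ENNReal.zero_lt_top, fun t _ => ?_⟩
    simp

/-! ## Discharged TRUE step: Step 3 (append-only; ns-claims D-0026 debt pass, typist-9 g4) -/

/-- The linear pressure of §3.2 p.12 as the affine functional `y ↦ ⟪f·(1,1,1), y⟫ + K`. [folklore] -/
private theorem linearPressure_eq_inner (f K : ℝ) :
    (fun y : EuclideanSpace ℝ (Fin 3) => f * (y 0 + y 1 + y 2) + K) =
      fun y => ⟪f • ones, y⟫_ℝ + K := by
  funext y
  simp only [ones, PiLp.inner_apply, PiLp.smul_apply, RCLike.inner_apply, conj_trivial,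
    Fin.sum_univ_three, smul_eq_mul, mul_one]
  ring

/-- `∇(y ↦ ⟪c, y⟫_ℝ + K) = c` (Riesz). [folklore] -/
private theorem gradient_inner_add_const (c : EuclideanSpace ℝ (Fin 3)) (K : ℝ)
    (x : EuclideanSpace ℝ (Fin 3)) :
    gradient (fun y : EuclideanSpace ℝ (Fin 3) => ⟪c, y⟫_ℝ + K) x = c := by
  have h : HasFDerivAt (fun y : EuclideanSpace ℝ (Fin 3) => ⟪c, y⟫_ℝ) (innerSL ℝ c) x :=
    (innerSL ℝ c).hasFDerivAt
  rw [gradient, fderiv_add_const, h.fderiv]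
  apply (InnerProductSpace.toDual ℝ (EuclideanSpace ℝ (Fin 3))).injective
  rw [LinearIsometryEquiv.apply_symm_apply]
  ext y
  simp [InnerProductSpace.toDual_apply_apply]

/-- The gradient of the §3.2 linear pressure is the constant field `f·(1,1,1)`.
[cite: ZhouXinyi2024, §3.2 p.12] -/
private theorem gradient_linearPressure (f K : ℝ) (x : EuclideanSpace ℝ (Fin 3)) :
    gradient (fun y : EuclideanSpace ℝ (Fin 3) => f * (y 0 + y 1 + y 2) + K) x = f • ones := by
  rw [linearPressure_eq_inner, gradient_inner_add_const]

/-- The §3.2 linear pressure is jointly smooth (it is an affine function of `x`, constant in `t`).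
[cite: ZhouXinyi2024, §3.2 p.12] -/
private theorem isSmoothSpaceTimeOn_linearPressure (f K : ℝ) :
    IsSmoothSpaceTimeOn univ
      (fun (_ : ℝ) (x : EuclideanSpace ℝ (Fin 3)) => f * (x 0 + x 1 + x 2) + K) := by
  have hin : ContDiff ℝ ∞ (fun y : EuclideanSpace ℝ (Fin 3) => ⟪f • ones, y⟫_ℝ + K) :=
    ((innerSL ℝ (f • ones)).contDiff).add contDiff_const
  have h2 : ContDiff ℝ ∞
      (uncurry fun (_ : ℝ) (x : EuclideanSpace ℝ (Fin 3)) => f * (x 0 + x 1 + x 2) + K) := by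
    have : (uncurry fun (_ : ℝ) (x : EuclideanSpace ℝ (Fin 3)) => f * (x 0 + x 1 + x 2) + K) =
        (fun y : EuclideanSpace ℝ (Fin 3) => ⟪f • ones, y⟫_ℝ + K) ∘ Prod.snd := by
      funext q
      simp only [uncurry, comp_apply]
      exact congrFun (linearPressure_eq_inner f K) q.2
    rw [this]
    exact hin.comp contDiff_snd
  exact h2.contDiffOn

/-- **STEP 3 holds** (§3.2 p.12, forced model with `f_x = f_y = f_z = f`): the constant velocity `c`
with the linear pressure `p = f·(x + y + z) + K` is a global classical solution of the system forced
by the constant field `f·(1,1,1)` — `∂ₜu = 0`, `(u·∇)u = 0`, `Δu = 0` and `∇p = f·(1,1,1)` balances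
the force. Discharge of the typist's «TRUE-looking» flag; not consumed by `ClaimedTheorem` and no
bearing on the row's verdict (#60, STATEMENT / wrong problem). [cite: ZhouXinyi2024, §3.2 p.12] -/
theorem step_3_holds : Step_3 := by
  intro ν f K c
  refine ⟨contDiffOn_const, isSmoothSpaceTimeOn_linearPressure f K, ?_, ?_⟩
  · intro t _ x
    have hΔ : (Δ fun _ : EuclideanSpace ℝ (Fin 3) => c) x = 0 := by
      rw [InnerProductSpace.laplacian_eq_iteratedFDeriv_stdOrthonormalBasis]
      simp [iteratedFDeriv_const_of_ne (𝕜 := ℝ) (E := EuclideanSpace ℝ (Fin 3)) two_ne_zero c]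
    have hg := gradient_linearPressure f K x
    simp [timeDerivWithin, convect, hΔ, hg]
  · intro t _ x
    simp [VectorCalculus.divergence]

end

end Literature.Claims.NS.ZhouXinyi2024
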